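import Summits.QuantumFields.BalabanUV.Beta.D1BFx.GluonKernelSectors
import Summits.QuantumFields.BalabanUV.Beta.D1BFx.PackedKernelSplitBounds

/-!
# `BalabanUV.Beta.D1BFx.ReducedKernelPackSplit` — road «BF-x» for binder row D1, slot (K), (S-N) dictionary, owner ruling ρ-g15-3 «ΔPACK-AS-REST»:
# THE REDUCED KERNEL OF A SUM OF FIRST-JET PACKS — `TOfRed n a (S + T) W = TOfRed n a S W − ½·(three cross∕square bubbles)`, and the
# `(5.10)`-decay ∕ `AbsMoment₂` of the three new words (so a pack DIFFERENCE `T := S_literal − SbfBal` enters the (K) row as NAMED REST KERNELS)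

HONEST DEPENDENCY (page 1, mandatory): continuum YM on T⁴ ⇐ BetaPertH ∧ nine spine estimates (0/9 proved); BetaPertH ⇐ (D1) ∧ (D4) ∧
CAP+tail; G-an2-4 gates asym, D1 and NE2/3/4.  HONEST FRAMING (cell contract, verbatim): «discharging `BetaPertH` makes Bałaban's UV
stability UNCONDITIONAL — a real constructive-QFT result; it is NOT the continuum limit and NOT the Clay problem.»  THIS MODULE DISCHARGES
NOTHING of the wall: [folklore] bilinearity of the bubble on localised vertices over a spread leg (`TameKernelCalculus.bubble_add_left∕right`),
additivity of the reduced chain-rule vertex (`GluonKernelSectors.vertexRed_add`), and the two-leg bubble word's decay (`PackedKernelSplitBounds.decay510_biBubbleWord`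
with both legs `Ga n a`) BY NAME.  No definition, no `def … : Prop`, nothing cited, 0 sorry.  The leg's decay `Spr (Ga n a)` ∕ `Decays (Ga n a) C δ` is a
DISPLAYED hypothesis (at the road's legs: the printed [B5] content via `GluonLegTails.spr_Ga_of_prop12`); the two packs' bond-localisations are displayed letters.
0 wall binders; (K) NOT closed; NOT D1, NOT `BetaPertH`, NOT continuum, NOT Clay.

ABSOLUTE RULE (cell charter, verbatim): «No internally-minted statement may enter as a cited fact. Every hypothesis is either kernel-proved in
this package or a verbatim quotation of a PUBLISHED theorem with page reference. The manuscript(s) under audit are NOT citable for their own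
disputed steps — they are the thing under adjudication; programme-internal (2001/route/tribunal) claims are never citable.»

WHY (owner ruling ρ-g15-3, journal [D1P2-G15-RULING-2]; `DICT-CHAIN-SPEC.md` §1 (S-N), §6 R-g14-1, ρ-g15-2).  The (S-N) dictionary must express the N-jets'
ff first-jet pack `S_lit n` of the literal of record (road FP's `JcOf`, an2 R-D1-g35-4) through the road's typed pack `SbfBal n a …`.  Rather than re-typing
the road's cells on `S_lit` (R-g14-1's feared 76-file blast radius), the road writes `S_lit = SbfBal + ΔS` and sends EVERY discrepancy `ΔS` (the Λ-sector's
table difference `cΛ • SLam n λ (H_lit − hessFF n)`, dressing∕unit terms per Q-JC-1′) INTO THE REST of the pointwise row `hptw`: by this file,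
`TOfRed n a (SbfBal + ΔS) W μ ν z = TOfRed n a SbfBal W μ ν z − ½·(bubble (Ga) (vR SbfBal μ 0) (vR ΔS ν z) + bubble (Ga) (vR ΔS μ 0) (vR SbfBal ν z)
+ bubble (Ga) (vR ΔS μ 0) (vR ΔS ν z))`, `vR := vertexRed n` — three NAMED kernels in `z`, each a `(5.10)`-kernel with `AbsMoment₂` (§2), i.e. three more
members of `Rk` with their `hMR` rows DISCHARGED here; their unit-class rows (`hRu`∕`hU`) are the Λ-mechanism's («S-GEN-LAM»: the generic G_Λ identities applied to
`H_lit − hessFF n`).  The END, the split∕census machinery and every landed cell stay AS TYPED on `SbfBal`.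

CONTENT ([folklore]; `n` the block side, `[NeZero n]`; `S T : StencilR` bond-localised: `BiLoc (S κ u) u u Cs δs`, `BiLoc (T κ u) u u Ct δt`).
* §1 **`TOfRed_add`** (`Spr (Ga n a)`): the displayed three-bubble split of `TOfRed n a (S + T) W`; `TOfRed_add_sub` (the same read as «literal pack = road pack +
  difference»: `TOfRed n a S' W = TOfRed n a S W − ½·(…)` for `S' = S + T`).
* §2 **`decay510_crossBubble`** (`Decays (Ga n a) C δ`): each of the three words `z ↦ bubble (Ga n a) (vertexRed n S μ 0) (vertexRed n T ν z)` is a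
  `(5.10)`-kernel at blocking `n` (`bubble = biBubble` with both legs `Ga`, `decay510_biBubbleWord` at the vertex families `vertexFamily_vertexRed'`);
  **`absMoment₂_crossBubble`** — hence `AbsMoment₂` (the `hMR` row of these rest members).
* §3 **`TOfRed_add_table`** (`Spr (Ga n a)`, localised tables): `TOfRed n a S (W + W′) = TOfRed n a S W + ½·tadpole (Ga n a) (W′ μ 0 ν z)` — the second-order
  table difference `ΔW` (the literal's Λ₂∕W-slot deviation from the road's `tableRed n (Wbf …)`) is ONE tadpole rest word; `decay510_tableWord`, **`absMoment₂_tableWord`**.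
Unit `b2b-balaban-beta-d1-p2` gen 15 (road «BF-x» OWNER); no existing file touched.
-/

noncomputable section

namespace Summit.QuantumFields.BalabanUV.Beta.D1BFx.ReducedKernelPackSplit

open Finset
open scoped BigOperators
open Literature.MathematicalPhysics.QuantumFieldTheory
open Literature.MathematicalPhysics.QuantumFieldTheory.Balaban1983to89
open Literature.MathematicalPhysics.QuantumFieldTheory.Balaban1983to89.Beta
open B12Sec2to5 (l1 l1_nonneg Decay510)
open ExpKernelCalculus (Site MKer Decays BiLoc VertexFamily hessKer bubble tadpole)
open DecimatedMomentSummable (AbsMoment₂ absMoment₂_of_decay510)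
open Summit.QuantumFields.BalabanUV.Beta.TameKernelCalculus (Spr Loc bubble_add_left bubble_add_right tadpole_add)
open Summit.QuantumFields.BalabanUV.Beta.D1BFx.GluonLeg (Ga)
open Summit.QuantumFields.BalabanUV.Beta.D1BFx.ReducedKernel (StencilR TableR vertexRed TOfRed vertexFamily_vertexRed')
open Summit.QuantumFields.BalabanUV.Beta.D1BFx.GluonKernelSectors (vertexRed_add)
open Summit.QuantumFields.BalabanUV.Beta.D1BFx.PackedKernelSplit (biBubble bubble_eq_biBubble)
open Summit.QuantumFields.BalabanUV.Beta.D1BFx.PackedKernelSplitBounds (decay510_biBubbleWord decay510_tadpoleWord)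

variable (n : ℕ) [NeZero n] {a : ℝ} {S T : StencilR} {Cs δs Ct δt : ℝ}

/-! ## §1 The reduced kernel of a sum of packs -/

/-- [folklore] The reduced vertex of a bond-localised pack is localised (`TameKernelCalculus.Loc`) at every coarse bond. -/
theorem loc_vertexRed (hS : ∀ κ u, BiLoc (S κ u) u u Cs δs) (hδs : 0 < δs) (μ : Fin 4) (y : Site 4) : Loc (vertexRed n S μ y) := by
  obtain ⟨Cv, δv, hδv, -, hV⟩ := vertexFamily_vertexRed' n hS hδs
  exact ⟨_, _, Cv, δv, hδv, hV μ y⟩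

/-- [folklore] **THE REDUCED KERNEL OF A SUM OF FIRST-JET PACKS** (spread gluon leg, both packs bond-localised): the tadpole is untouched (the table
`W` is a separate slot) and the bubble splits bilinearly —
`TOfRed n a (S + T) W μ ν z = TOfRed n a S W μ ν z − ½·(bubble G (vR S μ 0) (vR T ν z) + bubble G (vR T μ 0) (vR S ν z) + bubble G (vR T μ 0) (vR T ν z))`. -/
theorem TOfRed_add (hGa : Spr (Ga n a)) (hS : ∀ κ u, BiLoc (S κ u) u u Cs δs) (hδs : 0 < δs)
    (hT : ∀ κ u, BiLoc (T κ u) u u Ct δt) (hδt : 0 < δt) (W : TableR) (μ ν : Fin 4) (z : Site 4) :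
    TOfRed n a (fun κ u => S κ u + T κ u) W μ ν z =
      TOfRed n a S W μ ν z
        - (1 / 2) * (bubble (Ga n a) (vertexRed n S μ 0) (vertexRed n T ν z) + bubble (Ga n a) (vertexRed n T μ 0) (vertexRed n S ν z)
            + bubble (Ga n a) (vertexRed n T μ 0) (vertexRed n T ν z)) := by
  have hLS := loc_vertexRed n hS hδs
  have hLT := loc_vertexRed n hT hδt
  simp only [TOfRed, hessKer]
  rw [vertexRed_add n hS hδs.le hT hδt.le μ 0, vertexRed_add n hS hδs.le hT hδt.le ν z,
    bubble_add_left hGa (hLS μ 0) (hLT μ 0) ((hLS ν z).add (hLT ν z)),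
    bubble_add_right hGa (hLS μ 0) (hLS ν z) (hLT ν z), bubble_add_right hGa (hLT μ 0) (hLS ν z) (hLT ν z)]
  ring

/-- [folklore] The same read as «LITERAL PACK = ROAD PACK + DIFFERENCE»: if `S' κ u = S κ u + T κ u` then
`TOfRed n a S' W μ ν z = TOfRed n a S W μ ν z − ½·(the three words)` — the shape in which a pack discrepancy `T` joins the rest kernels `Rk` of `hptw`. -/
theorem TOfRed_add_sub (hGa : Spr (Ga n a)) (hS : ∀ κ u, BiLoc (S κ u) u u Cs δs) (hδs : 0 < δs)
    (hT : ∀ κ u, BiLoc (T κ u) u u Ct δt) (hδt : 0 < δt) {S' : StencilR} (hS' : ∀ κ u, S' κ u = S κ u + T κ u)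
    (W : TableR) (μ ν : Fin 4) (z : Site 4) :
    TOfRed n a S' W μ ν z =
      TOfRed n a S W μ ν z
        + (-(1 / 2) * bubble (Ga n a) (vertexRed n S μ 0) (vertexRed n T ν z)
           + -(1 / 2) * bubble (Ga n a) (vertexRed n T μ 0) (vertexRed n S ν z)
           + -(1 / 2) * bubble (Ga n a) (vertexRed n T μ 0) (vertexRed n T ν z)) := by
  have e : S' = fun κ u => S κ u + T κ u := funext fun κ => funext fun u => hS' κ u
  rw [e, TOfRed_add n hGa hS hδs hT hδt]
  ring

/-! ## §2 The three new words are (5.10)-kernels with absolutely summable second moments -/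

/-- [folklore] **A CROSS BUBBLE OF TWO REDUCED VERTICES IS A (5.10)-KERNEL**: for a decaying gluon leg and two bond-localised packs, the word
`z ↦ bubble (Ga n a) (vertexRed n S μ 0) (vertexRed n T ν z)` obeys `Decay510 · C′ δ′` for some `C′` and `δ′ > 0` (both legs `Ga`: `bubble = biBubble`,
`decay510_biBubbleWord` at the vertex families of `vertexFamily_vertexRed'`, rates equalised). -/
theorem decay510_crossBubble {C δ : ℝ} (hGa : Decays (Ga n a) C δ) (hδ : 0 < δ) (hS : ∀ κ u, BiLoc (S κ u) u u Cs δs) (hδs : 0 < δs)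
    (hT : ∀ κ u, BiLoc (T κ u) u u Ct δt) (hδt : 0 < δt) (μ ν : Fin 4) :
    ∃ C' δ' : ℝ, 0 < δ' ∧ Decay510 (fun z => bubble (Ga n a) (vertexRed n S μ 0) (vertexRed n T ν z)) C' δ' := by
  obtain ⟨CvS, δS, hδS, -, hVS⟩ := vertexFamily_vertexRed' n hS hδs
  obtain ⟨CvT, δT, hδT, -, hVT⟩ := vertexFamily_vertexRed' n hT hδt
  -- one common rate for the leg and the two vertex families
  set δ₀ : ℝ := min δ (min δS δT) with hδ₀
  have hδ₀pos : 0 < δ₀ := lt_min hδ (lt_min hδS hδT)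
  have hA₀ : Decays (Ga n a) (|C|) δ₀ := TameKernelCalculus.decays_of_le hGa (min_le_left _ _)
  have hVS₀ : VertexFamily (vertexRed n S) n (|CvS|) δ₀ := fun μ y =>
    TameKernelCalculus.biLoc_of_le (hVS μ y) ((min_le_right _ _).trans (min_le_left _ _))
  have hVT₀ : VertexFamily (vertexRed n T) n (|CvT|) δ₀ := fun μ y =>
    TameKernelCalculus.biLoc_of_le (hVT μ y) ((min_le_right _ _).trans (min_le_right _ _))
  have h := decay510_biBubbleWord hA₀ hA₀ hVS₀ hVT₀ hδ₀pos NeZero.one_le μ ν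
  -- `bubble A V W = biBubble A V A W` by `rfl` (`bubble_eq_biBubble`), so `h` is the claim up to unfolding
  exact ⟨_, δ₀ / 4, by positivity, h⟩

/-- [folklore] **… HENCE ITS SECOND MOMENTS ARE ABSOLUTELY SUMMABLE** — the `hMR` row of the three ΔPACK rest words (apply with `(S, T)`, `(T, S)`, `(T, T)`). -/
theorem absMoment₂_crossBubble {C δ : ℝ} (hGa : Decays (Ga n a) C δ) (hδ : 0 < δ) (hS : ∀ κ u, BiLoc (S κ u) u u Cs δs) (hδs : 0 < δs)
    (hT : ∀ κ u, BiLoc (T κ u) u u Ct δt) (hδt : 0 < δt) (μ ν : Fin 4) :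
    AbsMoment₂ (fun z => bubble (Ga n a) (vertexRed n S μ 0) (vertexRed n T ν z)) := by
  obtain ⟨C', δ', hδ', h⟩ := decay510_crossBubble n hGa hδ hS hδs hT hδt μ ν
  exact absMoment₂_of_decay510 hδ' h

/-! ## §3 The reduced kernel of a sum of second-order tables (the Λ₂∕W-slot difference as ONE tadpole rest word) -/

variable {W W' : TableR}

/-- [folklore] **THE REDUCED KERNEL OF A SUM OF SECOND-ORDER TABLES**: the bubble is untouched and the tadpole is additive on localised tables —
`TOfRed n a S (W + W′) μ ν z = TOfRed n a S W μ ν z + ½·tadpole (Ga n a) (W′ μ 0 ν z)`.  With §1: a literal whose first-jet pack AND second-order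
table differ from the road's by `(ΔS, ΔW)` contributes exactly four named rest words (three bubbles, one tadpole). -/
theorem TOfRed_add_table (hGa : Spr (Ga n a)) (hW : ∀ μ y ν y', Loc (W μ y ν y')) (hW' : ∀ μ y ν y', Loc (W' μ y ν y')) (S : StencilR)
    (μ ν : Fin 4) (z : Site 4) :
    TOfRed n a S (fun μ y ν y' => W μ y ν y' + W' μ y ν y') μ ν z = TOfRed n a S W μ ν z + (1 / 2) * tadpole (Ga n a) (W' μ 0 ν z) := by
  simp only [TOfRed, hessKer]
  rw [tadpole_add hGa (hW μ 0 ν z) (hW' μ 0 ν z)]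
  ring

/-- [folklore] **THE TABLE-DIFFERENCE TADPOLE WORD IS A (5.10)-KERNEL**: for a decaying gluon leg and a second-order vertex family `W′` at blocking `n`
(`VertexFamily₂ W′ n Cw δw`), `z ↦ tadpole (Ga n a) (W′ μ 0 ν z)` obeys `Decay510 · C′ δ′` for some `C′`, `δ′ > 0` (`decay510_tadpoleWord`, rates equalised). -/
theorem decay510_tableWord {C δ Cw δw : ℝ} (hGa : Decays (Ga n a) C δ) (hδ : 0 < δ) (hW' : ExpKernelCalculus.VertexFamily₂ W' n Cw δw)
    (hδw : 0 < δw) (μ ν : Fin 4) : ∃ C' δ' : ℝ, 0 < δ' ∧ Decay510 (fun z => tadpole (Ga n a) (W' μ 0 ν z)) C' δ' := by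
  set δ₀ : ℝ := min δ δw with hδ₀
  have hδ₀pos : 0 < δ₀ := lt_min hδ hδw
  have hA₀ : Decays (Ga n a) (|C|) δ₀ := TameKernelCalculus.decays_of_le hGa (min_le_left _ _)
  have hW₀ : ExpKernelCalculus.VertexFamily₂ W' n (|Cw|) δ₀ := fun μ y ν y' =>
    TameKernelCalculus.biLoc_of_le (hW' μ y ν y') (min_le_right _ _)
  exact ⟨_, δ₀ / 4, by positivity, decay510_tadpoleWord hA₀ hW₀ hδ₀pos NeZero.one_le μ ν⟩

/-- [folklore] … hence `AbsMoment₂` — the `hMR` row of the table-difference rest word. -/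
theorem absMoment₂_tableWord {C δ Cw δw : ℝ} (hGa : Decays (Ga n a) C δ) (hδ : 0 < δ) (hW' : ExpKernelCalculus.VertexFamily₂ W' n Cw δw)
    (hδw : 0 < δw) (μ ν : Fin 4) : AbsMoment₂ (fun z => tadpole (Ga n a) (W' μ 0 ν z)) := by
  obtain ⟨C', δ', hδ', h⟩ := decay510_tableWord n hGa hδ hW' hδw μ ν
  exact absMoment₂_of_decay510 hδ' h

end Summit.QuantumFields.BalabanUV.Beta.D1BFx.ReducedKernelPackSplit

end
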